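import Mathlib

/-!
# Bernstein discrete moments of a completely monotone sequence converge

For a real sequence `a` write `λ_{N,j} := C(N,j) · ∑_{i ≤ N-j} (-1)^i C(N-j,i) a(j+i)` (`j ≤ N`) for
the Bernstein weights of `a`. If `a` is completely monotone (all iterated alternating differences
`∑_{i ≤ k} (-1)^i C(k,i) a(n+i)` are nonnegative) the weights are nonnegative, and granted the exact
Bernstein identity `∑_{j ≤ N} [C(j,n)/C(N,n)] λ_{N,j} = a n` (`n ≤ N`), the moments of the discrete
measures `∑_j λ_{N,j} δ_{j/N}` on `[0,1]` converge: `∑_{j ≤ N} (j/N)^n λ_{N,j} → a n` as `N → ∞`.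
This is the limiting step in the proof of Hausdorff's moment theorem (completely monotone
sequences are the moment sequences of finite measures on `[0,1]`), C. Berg, J. P. R. Christensen,
P. Ressel, *Harmonic Analysis on Semigroups*, Springer GTM 100 (1984), Ch. 4, Prop. 6.11 (proof);
F. Hausdorff, Math. Z. 9 (1921). [BergChristensenRessel1984]

Proof: `C(j,n)/C(N,n) = ∏_{i<n} (j-i)/(N-i)` and `(j/N)^n = ∏_{i<n} j/N` are products of numbers in
`[0,1]` whose factors differ by at most `i/N`, so `|(j/N)^n - C(j,n)/C(N,n)| ≤ n²/N` uniformly in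
`j ≤ N`; the weights are nonnegative of total mass `a 0`, whence
`|∑_j (j/N)^n λ_{N,j} - a n| ≤ (n²/N) · a 0 → 0`.

* `HausdorffMomentBernsteinLimit.abs_prod_sub_prod_le` — `|∏ f - ∏ g| ≤ ∑ |f i - g i|` on `[-1,1]`.
* `HausdorffMomentBernsteinLimit.choose_div_choose_eq_prod` — `C(j,n)/C(N,n) = ∏_{i<n} (j-i)/(N-i)`.
* `HausdorffMomentBernsteinLimit.abs_pow_div_sub_choose_div_choose_le` — the uniform bound.
* `bernsteinWeights_moment_tendsto` — the convergence of the Bernstein moments.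

## References

* C. Berg, J. P. R. Christensen, P. Ressel, *Harmonic Analysis on Semigroups. Theory of Positive
  Definite and Related Functions*, Graduate Texts in Mathematics 100, Springer (1984), Ch. 4,
  Prop. 6.11. [BergChristensenRessel1984]
* F. Hausdorff, *Summationsmethoden und Momentfolgen. I*, Math. Z. 9 (1921), 74–109.
-/

noncomputable section

open MeasureTheory Set Filter Topology

namespace Literature.MeasureTheory.Integral

namespace HausdorffMomentBernsteinLimit

/-! ## 1. Products of numbers in `[-1,1]` -/

/-- For real numbers of absolute value at most one, the difference of the products is bounded by
the sum of the differences: `|∏_{i<n} f i - ∏_{i<n} g i| ≤ ∑_{i<n} |f i - g i|`. [folklore] -/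
theorem abs_prod_sub_prod_le (f g : ℕ → ℝ) (n : ℕ) (hf : ∀ i < n, |f i| ≤ 1)
    (hg : ∀ i < n, |g i| ≤ 1) :
    |∏ i ∈ Finset.range n, f i - ∏ i ∈ Finset.range n, g i| ≤
      ∑ i ∈ Finset.range n, |f i - g i| := by
  induction n with
  | zero => simp
  | succ n ih =>
    have hf' : ∀ i < n, |f i| ≤ 1 := fun i hi => hf i (Nat.lt_succ_of_lt hi)
    have hg' : ∀ i < n, |g i| ≤ 1 := fun i hi => hg i (Nat.lt_succ_of_lt hi)
    have hPg : |∏ i ∈ Finset.range n, g i| ≤ 1 := by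
      rw [Finset.abs_prod]
      exact Finset.prod_le_one (fun i _ => abs_nonneg _)
        (fun i hi => hg' i (Finset.mem_range.mp hi))
    have hfn : |f n| ≤ 1 := hf n (Nat.lt_succ_self n)
    rw [Finset.prod_range_succ, Finset.prod_range_succ, Finset.sum_range_succ]
    calc |(∏ i ∈ Finset.range n, f i) * f n - (∏ i ∈ Finset.range n, g i) * g n|
        = |(∏ i ∈ Finset.range n, f i - ∏ i ∈ Finset.range n, g i) * f n +
            (∏ i ∈ Finset.range n, g i) * (f n - g n)| := by
          congr 1
          ring
      _ ≤ |(∏ i ∈ Finset.range n, f i - ∏ i ∈ Finset.range n, g i) * f n| +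
            |(∏ i ∈ Finset.range n, g i) * (f n - g n)| := abs_add_le _ _
      _ = |∏ i ∈ Finset.range n, f i - ∏ i ∈ Finset.range n, g i| * |f n| +
            |∏ i ∈ Finset.range n, g i| * |f n - g n| := by
          rw [abs_mul, abs_mul]
      _ ≤ |∏ i ∈ Finset.range n, f i - ∏ i ∈ Finset.range n, g i| * 1 + 1 * |f n - g n| := by
          gcongr
      _ ≤ ∑ i ∈ Finset.range n, |f i - g i| + |f n - g n| := by
          rw [mul_one, one_mul]
          have := ih hf' hg'
          linarith

/-! ## 2. The ratio of binomial coefficients as a product -/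

/-- `C(j,n)/C(N,n) = ∏_{i<n} (j-i)/(N-i)` (with truncated subtraction; both sides vanish when
`N < n`). [folklore] -/
theorem choose_div_choose_eq_prod (N n j : ℕ) :
    (j.choose n : ℝ) / (N.choose n : ℝ) =
      ∏ i ∈ Finset.range n, ((j - i : ℕ) : ℝ) / ((N - i : ℕ) : ℝ) := by
  have hfac : ((n.factorial : ℕ) : ℝ) ≠ 0 := by exact_mod_cast Nat.factorial_ne_zero n
  rw [Finset.prod_div_distrib, ← Nat.cast_prod, ← Nat.cast_prod,
    ← Nat.descFactorial_eq_prod_range, ← Nat.descFactorial_eq_prod_range,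
    Nat.descFactorial_eq_factorial_mul_choose, Nat.descFactorial_eq_factorial_mul_choose,
    Nat.cast_mul, Nat.cast_mul, mul_div_mul_left _ _ hfac]

/-- The factors differ by at most `i/N`: `|j/N - (j-i)/(N-i)| ≤ i/N` for `i < N`, `j ≤ N`.
[folklore] -/
theorem abs_div_sub_tsub_div_tsub_le {N i j : ℕ} (hi : i < N) (hj : j ≤ N) :
    |(j : ℝ) / N - ((j - i : ℕ) : ℝ) / ((N - i : ℕ) : ℝ)| ≤ (i : ℝ) / N := by
  have hN : (0 : ℝ) < N := by exact_mod_cast (Nat.zero_le i).trans_lt hi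
  have hq : (0 : ℝ) < ((N - i : ℕ) : ℝ) := by exact_mod_cast Nat.sub_pos_of_lt hi
  have hqN : ((N - i : ℕ) : ℝ) + i = N := by exact_mod_cast Nat.sub_add_cancel hi.le
  have hp1 : ((j - i : ℕ) : ℝ) ≤ j := by exact_mod_cast Nat.sub_le j i
  have hp2 : (j : ℝ) ≤ ((j - i : ℕ) : ℝ) + i := by exact_mod_cast le_tsub_add
  have hp3 : ((j - i : ℕ) : ℝ) ≤ ((N - i : ℕ) : ℝ) := by exact_mod_cast Nat.sub_le_sub_right hj i
  have ht0 : 0 ≤ ((j - i : ℕ) : ℝ) / ((N - i : ℕ) : ℝ) := div_nonneg (Nat.cast_nonneg _) hq.le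
  have ht1 : ((j - i : ℕ) : ℝ) / ((N - i : ℕ) : ℝ) ≤ 1 := (div_le_one hq).mpr hp3
  have key : (j : ℝ) / N - ((j - i : ℕ) : ℝ) / ((N - i : ℕ) : ℝ) =
      (((j : ℝ) - ((j - i : ℕ) : ℝ)) - i * (((j - i : ℕ) : ℝ) / ((N - i : ℕ) : ℝ))) / N := by
    rw [eq_div_iff hN.ne', sub_mul, div_mul_cancel₀ _ hN.ne', ← hqN, mul_add,
      div_mul_cancel₀ _ hq.ne']
    ring
  rw [key, abs_div, abs_of_pos hN]
  gcongr
  rw [abs_le]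
  constructor
  · nlinarith [mul_le_of_le_one_right (Nat.cast_nonneg i) ht1]
  · nlinarith [mul_nonneg (Nat.cast_nonneg i) ht0]

/-! ## 3. The uniform bound -/

/-- The uniform bound `|(j/N)^n - C(j,n)/C(N,n)| ≤ n²/N` for `n ≤ N`, `0 < N`, `j ≤ N`.
[cite: BergChristensenRessel1984, Ch. 4, Prop. 6.11 (proof)] -/
theorem abs_pow_div_sub_choose_div_choose_le {N n j : ℕ} (hn : n ≤ N) (hN : 0 < N) (hj : j ≤ N) :
    |((j : ℝ) / N) ^ n - (j.choose n : ℝ) / (N.choose n : ℝ)| ≤ (n : ℝ) * n / N := by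
  have hN' : (0 : ℝ) ≤ N := Nat.cast_nonneg N
  have hjN : |(j : ℝ) / N| ≤ 1 := by
    rw [abs_of_nonneg (div_nonneg (Nat.cast_nonneg j) hN')]
    exact div_le_one_of_le₀ (by exact_mod_cast hj) hN'
  rw [choose_div_choose_eq_prod N n j, Finset.pow_eq_prod_const]
  calc |∏ _i ∈ Finset.range n, (j : ℝ) / N -
          ∏ i ∈ Finset.range n, ((j - i : ℕ) : ℝ) / ((N - i : ℕ) : ℝ)|
      ≤ ∑ i ∈ Finset.range n, |(j : ℝ) / N - ((j - i : ℕ) : ℝ) / ((N - i : ℕ) : ℝ)| :=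
        abs_prod_sub_prod_le _ _ n (fun _ _ => hjN) fun i _ => by
          rw [abs_of_nonneg (div_nonneg (Nat.cast_nonneg _) (Nat.cast_nonneg _))]
          exact div_le_one_of_le₀ (by exact_mod_cast Nat.sub_le_sub_right hj i) (Nat.cast_nonneg _)
    _ ≤ ∑ i ∈ Finset.range n, (n : ℝ) / N := Finset.sum_le_sum fun i hi => by
        have hin : i < n := Finset.mem_range.mp hi
        calc |(j : ℝ) / N - ((j - i : ℕ) : ℝ) / ((N - i : ℕ) : ℝ)| ≤ (i : ℝ) / N :=
              abs_div_sub_tsub_div_tsub_le (hin.trans_le hn) hj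
          _ ≤ (n : ℝ) / N := by
              gcongr
    _ = (n : ℝ) * n / N := by
        rw [Finset.sum_const, Finset.card_range, nsmul_eq_mul, mul_div_assoc]

/-! ## 4. Convergence of the discrete moments -/

/-- Abstract form: nonnegative weights `w N j` (`j ≤ N`) of constant total mass `m` satisfying the
exact identity `∑_j [C(j,n)/C(N,n)] w N j = c` for `N ≥ n` have `n`-th discrete moments
`∑_j (j/N)^n w N j → c`. [cite: BergChristensenRessel1984, Ch. 4, Prop. 6.11 (proof)] -/
theorem tendsto_sum_pow_div_mul_of_sum_choose_div_choose_mul {w : ℕ → ℕ → ℝ} {m c : ℝ} {n : ℕ}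
    (hw : ∀ N j, 0 ≤ w N j) (hmass : ∀ N, ∑ j ∈ Finset.range (N + 1), w N j = m)
    (hid : ∀ N, n ≤ N →
      ∑ j ∈ Finset.range (N + 1), ((j.choose n : ℝ) / (N.choose n : ℝ)) * w N j = c) :
    Tendsto (fun N : ℕ => ∑ j ∈ Finset.range (N + 1), ((j : ℝ) / (N : ℝ)) ^ n * w N j)
      atTop (𝓝 c) := by
  have hbound : ∀ N : ℕ, n ≤ N → 0 < N →
      |∑ j ∈ Finset.range (N + 1), ((j : ℝ) / (N : ℝ)) ^ n * w N j - c| ≤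
        (n : ℝ) * n / N * m := by
    intro N hnN hN
    rw [← hid N hnN, ← Finset.sum_sub_distrib]
    calc |∑ j ∈ Finset.range (N + 1),
            (((j : ℝ) / (N : ℝ)) ^ n * w N j - (j.choose n : ℝ) / (N.choose n : ℝ) * w N j)|
        ≤ ∑ j ∈ Finset.range (N + 1),
            |((j : ℝ) / (N : ℝ)) ^ n * w N j - (j.choose n : ℝ) / (N.choose n : ℝ) * w N j| :=
          Finset.abs_sum_le_sum_abs _ _
      _ ≤ ∑ j ∈ Finset.range (N + 1), (n : ℝ) * n / N * w N j :=
          Finset.sum_le_sum fun j hj => by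
            rw [← sub_mul, abs_mul, abs_of_nonneg (hw N j)]
            exact mul_le_mul_of_nonneg_right (abs_pow_div_sub_choose_div_choose_le hnN hN
              (Nat.lt_succ_iff.mp (Finset.mem_range.mp hj))) (hw N j)
      _ = (n : ℝ) * n / N * m := by
          rw [← Finset.mul_sum, hmass]
  have hlim : Tendsto (fun N : ℕ => (n : ℝ) * n / N * m) atTop (𝓝 0) := by
    have h := (tendsto_const_div_atTop_nhds_zero_nat ((n : ℝ) * n)).mul_const m
    rwa [zero_mul] at h
  rw [← tendsto_sub_nhds_zero_iff]
  refine squeeze_zero_norm' ?_ hlim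
  filter_upwards [eventually_ge_atTop n, eventually_gt_atTop 0] with N hnN hN
  rw [Real.norm_eq_abs]
  exact hbound N hnN hN

end HausdorffMomentBernsteinLimit

open HausdorffMomentBernsteinLimit in
/-- **Bernstein moments converge** (the limiting step of Hausdorff's moment theorem). Let `a` be a
completely monotone real sequence, `∑_{i ≤ k} (-1)^i C(k,i) a(n+i) ≥ 0` for all `n, k`, and write
`λ_{N,j} := C(N,j) ∑_{i ≤ N-j} (-1)^i C(N-j,i) a(j+i)` for its (nonnegative) Bernstein weights.
Granted the exact Bernstein identity `∑_{j ≤ N} [C(j,n)/C(N,n)] λ_{N,j} = a n` (`n ≤ N`), the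
moments of the discrete measures `∑_j λ_{N,j} δ_{j/N}` converge:
`∑_{j ≤ N} (j/N)^n λ_{N,j} → a n` as `N → ∞`, for every `n`.
[cite: BergChristensenRessel1984, Ch. 4, Prop. 6.11 (proof)] -/
theorem bernsteinWeights_moment_tendsto (a : ℕ → ℝ)
    (hCM : ∀ n k : ℕ, 0 ≤ ∑ i ∈ Finset.range (k + 1), (-1 : ℝ) ^ i * (k.choose i : ℝ) * a (n + i))
    (hid : ∀ N n : ℕ, n ≤ N → ∑ j ∈ Finset.range (N + 1), ((j.choose n : ℝ) / (N.choose n : ℝ)) *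
      ((N.choose j : ℝ) * ∑ i ∈ Finset.range (N - j + 1), (-1 : ℝ) ^ i * ((N - j).choose i : ℝ) * a (j + i))
      = a n) :
    ∀ n : ℕ, Tendsto (fun N : ℕ => ∑ j ∈ Finset.range (N + 1), ((j : ℝ) / (N : ℝ)) ^ n *
      ((N.choose j : ℝ) * ∑ i ∈ Finset.range (N - j + 1), (-1 : ℝ) ^ i * ((N - j).choose i : ℝ) * a (j + i)))
      atTop (𝓝 (a n)) := by
  intro n
  have hmass : ∀ N : ℕ, ∑ j ∈ Finset.range (N + 1), ((N.choose j : ℝ) *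
      ∑ i ∈ Finset.range (N - j + 1), (-1 : ℝ) ^ i * ((N - j).choose i : ℝ) * a (j + i)) = a 0 := by
    intro N
    simpa only [Nat.choose_zero_right, Nat.cast_one, div_one, one_mul] using hid N 0 (Nat.zero_le N)
  exact tendsto_sum_pow_div_mul_of_sum_choose_div_choose_mul
    (w := fun N j => (N.choose j : ℝ) *
      ∑ i ∈ Finset.range (N - j + 1), (-1 : ℝ) ^ i * ((N - j).choose i : ℝ) * a (j + i))
    (fun N j => mul_nonneg (Nat.cast_nonneg _) (hCM j (N - j))) hmass (fun N hN => hid N n hN)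

end Literature.MeasureTheory.Integral
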